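import Literature.Probability.RandomPlanarGeometry.SAWPulledLargeForceExpansionZdTenStep
import Literature.Probability.RandomPlanarGeometry.SAWCountZdRepeatSetShapes
import HarnessLib

/-!
# The shape census engine: shape classes of the `1/d`-symbols of `c_n(ℤ^d)` counted by a pruned depth-first search in the kernel

Topic `Literature/Probability/RandomPlanarGeometry` (the «SYMBOL POLYNOMIALITY» programme: `SAWCountZdRepeatSetShapes.lean` (a-p1 g22: the
shape class `shapeClass j u A` — canonical words of length `u` with `u − j` axes, every position repeated, run-wise reversal-free (`RunNoRev A`)
and with a run-wise repeat (`RunHasRep A`) for an adjacency vector `A`), `SAWCountZdSymbolPolynomiality.lean` (the `1/d`-symbol count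
`#T_j(n) = 2^n R_j(n)` with `R_j` a finite sum over the shape classes); the census framework is a-p3 g20's
`SAWPulledLargeForceExpansionZdWordSearch.lean` / `…ZdTenStep.lean`: the pruned depth-first search `dfsV`/`dfsN` over the canonical words,
`card_TL_class`, the first-occurrence symmetry `card_filter_eq_two_pow_mul_card`, the digit read-off `dfsN_eq_of_table`).

PRINTED CONTEXT (locators only; nothing is quoted digit-for-digit). Madras–Slade (1993) Definition 1.2.4 (types / patterns of walks), §1.1
eq. (1.1.8) p. 5 (the `1/d` expansion of `μ`). The census itself is the lane's; no number is taken from print.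

THIS FILE — a generic ENGINE that turns every shape-class cardinality into ONE kernel evaluation. The search STATE `ShSt` of a prefix carries
the reversed raw prefix, its length, the occurrence counts of the axes (`bumpCnt`), the reversal-pair mask (`revBit`, bit `k` = letters
`k, k+1` reversed) and the pair masks (`pairMask`) of the zero blocks of length `≥ 2` found by walking back from each new letter
(`zeroMasks`, on the displacement coordinates of `…ZdTenStep`: `addD`, `isZ`); `shUpd` is the update, `shOk u r` the PRUNING TEST (at most `r`
axes and the missing second occurrences still fit: `2(r − #axes) + Σ_a (2 − occ a)⁺ ≤ u − len`), `shCls c` the CLASS TEST of the adjacency vector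
coded by `c` (`adjOf u c`: bit `k` = positions `k, k+1` adjacent): `c &&& rv = 0` (run-wise reversal-free) and some zero-block mask `b` with
`b &&& c = b` (a run-wise repeat); `shV u r B` the base-`B` census value. READS (all PROVED): `st_shUpd_pre/len/cnt/zm`, ★ `testBit_st_shUpd_rv` /
★ `testBit_rv_iff` (the reversal mask), ★ `mem_zeroMasks_coords_iff` / `mem_zeroMasks_prefix_iff` / ★★ `mem_zmL_iff` (the zero-block masks are
exactly the pair masks of the vanishing blocks `bsumW τ i₀ i = 0`, `i₀ + 2 ≤ i`), `axes_lt_naxL`, ★ `cntL_eq` (occurrence counts under restricted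
growth), `sum_occ_eq_length`, ★ `shOk_st_iff`, `testBit_pairMask`, `land_eq_self_iff`, `land_eq_zero_iff'`, ★★ `shCls_st_iff`
(`shCls c` on the final state ⇔ `RunNoRev (adjOf L c) τ ∧ RunHasRep (adjOf L c) τ`), ★ `occ_rawW_eq_card`, ★ `isRep_iff_two_le_occ`,
★ `allRep_iff_occ`, ★★ `prefixOK_shOk_iff` (for a canonical word with `r` axes every prefix passes the pruning test iff every position is
repeated), `ShapeP` + ★ `shapeP_flipW_iff` (flip invariance), `shapeClass_eq_filter_TL`, and ★★★ `card_shapeClass_adjOf`: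
`#shapeClass_j(u, A_c) = 2^(u−j) · dfsN alwR (shUpd u) (shOk u (u−j)) shCls c (u−j) u shS0 0` — the reduced search count (first occurrences
positive) read in class `c` at `u − j` axes. THE `j = 4` KERNEL CELLS (last section): the reduced shape census of excess four — word lengths `u = 4, …, 8`, `u − 4` axes, classes = the
`2^{u−1}` adjacency vectors — as five `decide +kernel` evaluations `shV_four … shV_eight` of `shV u (u−4) 2³³` against the digit tables
`shTab4 … shTab8` (≈ 80 s of kernel time in all; `u = 4, 5` are empty), `dfsN_eq_shN` (the digits read) and ★★ `card_shapeClass_four`: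
`#shapeClass_4(u, A_c) = 2^(u−4) · shN u c` for `4 ≤ u ≤ 8`, `c < 2^(u−1)`. The sequel `SAWCountZdFifthCoefficient.lean` assembles `R₄` from these
counts and makes the fifth `1/d`-coefficient law (L1′) unconditional. The definitions `ShSt`, `shS0`, `bumpCnt`, `pairMask`, `zeroMasks`, `revBit`, `shUpd`, `shOk`,
`shCls`, `shV`, `cntL`, `zmL`, `occ`, `adjOf`, `ShapeP`, `shTab4 … shTab8`, `shTab`, `shN` are this file's tool notions (not notions in print); no number is
taken from print — the tables are the kernel's own evaluation of the engine, reproduced beforehand by the lane's enumerators (a-p1 g22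
`shapes_direct.py`; a-ref-2 g58 / a-ref-1 g67 independent recounts of `N₄` and `b₄(7..13)`, FINDING-ZD-SYMBOL-POLYNOMIALITY §3).
[cite: MadrasSlade1993, Definition 1.2.4; §1.1 eq. (1.1.8) p. 5]

Provenance: lane «pcv-sawmu», a-p1 g23 (2026-08-27), design `HOME/pub-sawmu-a-p1/g22/sympoly/DESIGN-next-car-epsilon-KERNEL-CENSUS.md` (a-p1 g22).
-/

open Finset
open scoped BigOperators
open Literature.Probability.LatticeModels
open Literature.Probability.RandomPlanarGeometry.SAW
open Literature.Probability.Percolation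

namespace Literature.Probability.RandomPlanarGeometry.SAW.Zd

namespace WordTypes

/-! ### The search state and its update -/

section defs

/-- Search state for the shape census: the reversed raw prefix, its length, the occurrence counts of the axes (in order of first
occurrence), the reversal-pair mask (bit `k` set iff letters `k, k+1` are a reversal), and the pair masks of the zero blocks of length
`≥ 2` seen so far. [cite: MadrasSlade1993, Definition 1.2.4; lane tool notion] -/
structure ShSt where
  /-- reversed raw prefix -/
  pre : List (ℕ × Bool)
  /-- prefix length -/
  len : ℕ
  /-- occurrence counts per axis -/
  cnt : List ℕ
  /-- reversal-pair mask -/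
  rv : ℕ
  /-- zero-block pair masks -/
  zm : List ℕ

/-- The state of the empty prefix. [cite: MadrasSlade1993, Definition 1.2.4; lane tool notion] -/
def shS0 : ShSt := ⟨[], 0, [], 0, []⟩

/-- Bump the occurrence count of axis `a`; a new axis is appended with count one. [cite: MadrasSlade1993, Definition 1.2.4; lane tool notion] -/
def bumpCnt (cnt : List ℕ) (a : ℕ) : List ℕ := if a < cnt.length then cnt.modify a (· + 1) else cnt ++ [1]

/-- The pair mask of the block `[i, i')`: bits `i, …, i' − 2` (its internal adjacent pairs). [cite: MadrasSlade1993, Definition 1.2.4; lane tool notion] -/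
def pairMask (i i' : ℕ) : ℕ := (2 ^ (i' - 1 - i) - 1) * 2 ^ i

/-- Walking back over a reversed prefix of a prefix of length `len`, from displacement `D` reached after `k` letters: the pair masks of the
zero blocks `[len − k', len)` of length `k' ≥ 2`. [cite: MadrasSlade1993, Definition 1.2.4; lane tool notion] -/
def zeroMasks (len : ℕ) : List ℤ → ℕ → List (ℕ × Bool) → List ℕ
  | _, _, [] => []
  | D, k, a :: rest =>
    (if 2 ≤ k + 1 ∧ isZ (addD D a) = true then [pairMask (len - (k + 1)) len] else []) ++ zeroMasks len (addD D a) (k + 1) rest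

/-- The new reversal bit when letter `a` is appended at position `len`: set iff the previous letter is the reverse of `a`.
[cite: MadrasSlade1993, Definition 1.2.4; lane tool notion] -/
def revBit (pre : List (ℕ × Bool)) (len : ℕ) (a : ℕ × Bool) : ℕ :=
  match pre with
  | [] => 0
  | b :: _ => if b = (a.1, !a.2) then 2 ^ (len - 1) else 0

/-- State update by one raw letter (`n` = number of available axes, the length of the displacement vector).
[cite: MadrasSlade1993, Definition 1.2.4; lane tool notion] -/
def shUpd (n : ℕ) (s : ShSt) (a : ℕ × Bool) : ShSt :=
  { pre := a :: s.pre
    len := s.len + 1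
    cnt := bumpCnt s.cnt a.1
    rv := s.rv ||| revBit s.pre s.len a
    zm := s.zm ++ zeroMasks (s.len + 1) (List.replicate n 0) 0 (a :: s.pre) }

/-- Pruning test for words of length `u` with `r` axes, every axis occurring at least twice: at most `r` axes so far, and the missing
occurrences fit in the remaining letters. [cite: MadrasSlade1993, Definition 1.2.4; lane tool notion] -/
def shOk (u r : ℕ) (s : ShSt) : Bool :=
  decide (s.cnt.length ≤ r) && decide (2 * (r - s.cnt.length) + (s.cnt.map (2 - ·)).sum ≤ u - s.len)

/-- Class test for the adjacency vector coded by `c` (bit `k` = positions `k, k+1` adjacent): no reversal across an adjacent pair, and some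
zero block all of whose internal pairs are adjacent. [cite: MadrasSlade1993, Definition 1.2.4; lane tool notion] -/
def shCls (c : ℕ) (s : ShSt) : Bool :=
  (c &&& s.rv == 0) && s.zm.any fun b => b &&& c == b

/-- The census value for word length `u`, `r` axes, over `u` available axes: classes `c < 2^(u-1)`, stride `u + 1`, base `B`; reduced search
(first occurrences positive). [cite: MadrasSlade1993, Definition 1.2.4; lane tool notion] -/
def shV (u r B : ℕ) : ℕ := dfsV alwR (shUpd u) (shOk u r) shCls (2 ^ (u - 1)) (u + 1) B u shS0 0

end defs

/-! ### The state of a prefix, field by field -/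

section fields

variable (n : ℕ)

/-- The occurrence counts of a raw word, letter by letter. [cite: MadrasSlade1993, Definition 1.2.4; lane plumbing] -/
def cntL (w : List (ℕ × Bool)) : List ℕ := w.foldl (fun cnt a => bumpCnt cnt a.1) []

/-- The zero-block masks of a raw word: those ending at each position, in order. [cite: MadrasSlade1993, Definition 1.2.4; lane plumbing] -/
def zmL (w : List (ℕ × Bool)) : List ℕ :=
  (List.range w.length).flatMap fun i => zeroMasks (i + 1) (List.replicate n 0) 0 (w.take (i + 1)).reverse

/-- The state of a prefix: `pre` is the reversed prefix. [cite: MadrasSlade1993, Definition 1.2.4; lane plumbing] -/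
theorem st_shUpd_pre (w : List (ℕ × Bool)) : (st (shUpd n) shS0 w).pre = w.reverse := by
  unfold st
  suffices h : ∀ s : ShSt, (w.foldl (shUpd n) s).pre = w.reverse ++ s.pre by simpa [shS0] using h shS0
  induction w with
  | nil => intro s; rfl
  | cons a w ih => intro s; rw [List.foldl_cons, ih]; simp [shUpd]

/-- The state of a prefix: `len` is its length. [cite: MadrasSlade1993, Definition 1.2.4; lane plumbing] -/
theorem st_shUpd_len (w : List (ℕ × Bool)) : (st (shUpd n) shS0 w).len = w.length := by
  unfold st
  suffices h : ∀ s : ShSt, (w.foldl (shUpd n) s).len = w.length + s.len by simpa [shS0] using h shS0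
  induction w with
  | nil => intro s; simp
  | cons a w ih => intro s; rw [List.foldl_cons, ih]; simp [shUpd]; omega

/-- The state of a prefix: `cnt` is `cntL`. [cite: MadrasSlade1993, Definition 1.2.4; lane plumbing] -/
theorem st_shUpd_cnt (w : List (ℕ × Bool)) : (st (shUpd n) shS0 w).cnt = cntL w := by
  unfold st cntL
  suffices h : ∀ s : ShSt, (w.foldl (shUpd n) s).cnt = w.foldl (fun cnt a => bumpCnt cnt a.1) s.cnt by
    simpa [shS0] using h shS0
  induction w with
  | nil => intro s; rfl
  | cons a w ih => intro s; rw [List.foldl_cons, ih]; simp [shUpd]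

/-- One more letter: the update of the full state. [cite: MadrasSlade1993, Definition 1.2.4; lane plumbing] -/
theorem st_shUpd_append_singleton (w : List (ℕ × Bool)) (a : ℕ × Bool) :
    st (shUpd n) shS0 (w ++ [a]) = shUpd n (st (shUpd n) shS0 w) a := st_append_singleton _ _ _ _

/-- The state of a prefix: `zm` is `zmL`. [cite: MadrasSlade1993, Definition 1.2.4; lane plumbing] -/
theorem st_shUpd_zm (w : List (ℕ × Bool)) : (st (shUpd n) shS0 w).zm = zmL n w := by
  induction w using List.reverseRecOn with
  | nil => rfl
  | append_singleton w a ih =>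
    rw [st_shUpd_append_singleton, zmL]
    change (st (shUpd n) shS0 w).zm ++ zeroMasks ((st (shUpd n) shS0 w).len + 1) (List.replicate n 0) 0 (a :: (st (shUpd n) shS0 w).pre) = _
    rw [ih, st_shUpd_len, st_shUpd_pre, zmL, List.length_append, List.length_singleton, List.range_succ, List.flatMap_append,
      List.flatMap_singleton]
    congr 1
    · refine List.flatMap_congr fun i hi => ?_
      rw [List.mem_range] at hi
      rw [List.take_append_of_le_length (by omega)]
    · rw [List.take_of_length_le (by simp), List.reverse_append]; rfl

end fields

/-! ### The reversal mask read -/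

section revmask

variable (n : ℕ)

/-- One more letter: the reversal mask gains the bit of the new pair when the new letter reverses the previous one.
[cite: MadrasSlade1993, Definition 1.2.4; lane plumbing] -/
theorem st_shUpd_rv_append (w : List (ℕ × Bool)) (a : ℕ × Bool) :
    (st (shUpd n) shS0 (w ++ [a])).rv = (st (shUpd n) shS0 w).rv ||| revBit w.reverse w.length a := by
  rw [st_shUpd_append_singleton]
  change (st (shUpd n) shS0 w).rv ||| revBit (st (shUpd n) shS0 w).pre (st (shUpd n) shS0 w).len a = _
  rw [st_shUpd_pre, st_shUpd_len]

/-- The bits of `revBit`. [cite: MadrasSlade1993, Definition 1.2.4; lane plumbing] -/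
theorem testBit_revBit (w : List (ℕ × Bool)) (a : ℕ × Bool) (k : ℕ) :
    (revBit w.reverse w.length a).testBit k = true ↔ k + 1 = w.length ∧ w[k]? = some (a.1, !a.2) := by
  unfold revBit
  rcases w.eq_nil_or_concat with rfl | ⟨w', b, rfl⟩
  · simp
  · simp only [List.concat_eq_append, List.reverse_append, List.reverse_singleton, List.singleton_append, List.length_append,
      List.length_singleton, Nat.add_sub_cancel]
    by_cases hb : b = (a.1, !a.2)
    · rw [if_pos hb, Nat.testBit_two_pow, decide_eq_true_iff]
      constructor
      · rintro rfl; exact ⟨rfl, by rw [List.getElem?_append_right (le_refl _), Nat.sub_self, List.getElem?_singleton, if_pos rfl, hb]⟩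
      · rintro ⟨hk, -⟩; omega
    · rw [if_neg hb, Nat.zero_testBit]
      simp only [Bool.false_eq_true, false_iff, not_and]
      intro hk
      have hk' : k = w'.length := by omega
      subst hk'
      rw [List.getElem?_append_right (le_refl _), Nat.sub_self, List.getElem?_singleton, if_pos rfl, Option.some_inj]
      exact hb

/-- ★ THE REVERSAL MASK READ: bit `k` of the mask of a raw word `w` is set iff letters `k, k+1` of `w` form a reversal.
[cite: MadrasSlade1993, Definition 1.2.4; lane lemma] -/
theorem testBit_st_shUpd_rv (w : List (ℕ × Bool)) (k : ℕ) :
    (st (shUpd n) shS0 w).rv.testBit k = true ↔ ∃ x, w[k]? = some x ∧ w[k + 1]? = some (x.1, !x.2) := by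
  induction w using List.reverseRecOn with
  | nil => simp [st, shS0]
  | append_singleton w a ih =>
    rw [st_shUpd_rv_append, Nat.testBit_or, Bool.or_eq_true, ih, testBit_revBit]
    constructor
    · rintro (⟨x, h1, h2⟩ | ⟨hk, hw⟩)
      · have hk1 : k + 1 < w.length := by
          by_contra hh; rw [List.getElem?_eq_none (by omega)] at h2; exact absurd h2 (by simp)
        exact ⟨x, by rw [List.getElem?_append_left (by omega), h1], by rw [List.getElem?_append_left hk1, h2]⟩
      · have hk1 : k < w.length := by omega
        obtain ⟨x, hx⟩ : ∃ x, w[k]? = some x := ⟨w[k], List.getElem?_eq_getElem hk1⟩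
        refine ⟨x, by rw [List.getElem?_append_left hk1, hx], ?_⟩
        rw [List.getElem?_append_right (by omega), hk, Nat.sub_self, List.getElem?_singleton, if_pos rfl]
        rw [hx, Option.some_inj] at hw
        rw [hw]; simp
    · rintro ⟨x, h1, h2⟩
      by_cases hk1 : k + 1 < w.length
      · left; exact ⟨x, by rwa [List.getElem?_append_left (by omega)] at h1, by rwa [List.getElem?_append_left hk1] at h2⟩
      · right
        have hlen : k + 1 < w.length + 1 := by
          by_contra hh
          rw [List.getElem?_eq_none (by simp; omega)] at h2; exact absurd h2 (by simp)
        have hk : k + 1 = w.length := by omega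
        refine ⟨hk, ?_⟩
        rw [List.getElem?_append_left (by omega)] at h1
        rw [List.getElem?_append_right (by omega), hk, Nat.sub_self, List.getElem?_singleton, if_pos rfl, Option.some_inj] at h2
        rw [h1, h2]; simp

end revmask

/-! ### The zero-block masks read -/

section zeromasks

variable {L n : ℕ}

/-- ★ `zeroMasks` on coordinates: walking back over letters `l` (newest first) from the vector `v` reached after `k` letters, the masks
produced are those of the initial runs `l.take j` (`j ≥ 1`, `k + j ≥ 2`) that bring the vector to zero. [cite: MadrasSlade1993, Definition 1.2.4; lane lemma] -/
theorem mem_zeroMasks_coords_iff (len : ℕ) : ∀ (l : List (Idx n)) (v : Site (n + 1)) (k : ℕ) (b : ℕ), v 0 = 0 →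
    (b ∈ zeroMasks len (coords v) k (l.map raw) ↔
      ∃ j, 1 ≤ j ∧ j ≤ l.length ∧ 2 ≤ k + j ∧ v + vecL (l.take j) = 0 ∧ b = pairMask (len - (k + j)) len) := by
  intro l
  induction l with
  | nil =>
    intro v k b _
    simp only [List.map_nil, zeroMasks, List.not_mem_nil, List.length_nil, false_iff, not_exists, not_and]
    intro j hj hj0; omega
  | cons a l ih =>
    intro v k b hv
    have hv' : (v + twoStepV n a) 0 = 0 := by rw [Pi.add_apply, hv, twoStepV_apply_zero, add_zero]
    have hiff := isZ_coords_iff (v + twoStepV n a) hv'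
    rw [List.map_cons, zeroMasks, addD_coords, List.mem_append, ih _ _ _ hv']
    constructor
    · rintro (h | ⟨j, hj1, hjl, hkj, hz, hb⟩)
      · by_cases hc : 2 ≤ k + 1 ∧ isZ (coords (v + twoStepV n a)) = true
        · rw [if_pos hc, List.mem_singleton] at h
          refine ⟨1, le_rfl, by simp, hc.1, ?_, h⟩
          simpa [vecL] using hiff.1 hc.2
        · rw [if_neg hc] at h; simp at h
      · refine ⟨j + 1, by omega, by simp; omega, by omega, ?_, by rw [hb]; congr 2; omega⟩
        rw [List.take_succ_cons, vecL_cons, ← add_assoc]; exact hz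
    · rintro ⟨j, hj1, hjl, hkj, hz, hb⟩
      rcases Nat.eq_or_lt_of_le hj1 with rfl | hj
      · left
        have hz' : v + twoStepV n a = 0 := by simpa [vecL] using hz
        rw [if_pos ⟨hkj, hiff.2 hz'⟩, List.mem_singleton, hb]
      · right
        obtain ⟨j', rfl⟩ : ∃ j', j = j' + 1 := ⟨j - 1, by omega⟩
        refine ⟨j', by omega, by simp at hjl; omega, by omega, ?_, by rw [hb]; congr 2; omega⟩
        rw [List.take_succ_cons, vecL_cons, ← add_assoc] at hz; exact hz

/-- ★ The masks produced at position `i ≤ L` of a word: those of the zero blocks `[i − j, i)` of length `j ≥ 2`.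
[cite: MadrasSlade1993, Definition 1.2.4; lane lemma] -/
theorem mem_zeroMasks_prefix_iff (τ : Word L n) {i : ℕ} (hi : i ≤ L) (b : ℕ) :
    b ∈ zeroMasks i (List.replicate n 0) 0 ((rawW τ).take i).reverse ↔
      ∃ j, 2 ≤ j ∧ j ≤ i ∧ bsumW τ (i - j) i = 0 ∧ b = pairMask (i - j) i := by
  rw [rawW_eq_map, ← List.map_take, ← List.map_reverse, ← coords_zero, mem_zeroMasks_coords_iff i _ _ 0 b rfl]
  simp only [zero_add, List.length_reverse, List.length_take, List.length_ofFn, Nat.min_eq_left hi]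
  constructor
  · rintro ⟨j, -, hji, h2, hz, hb⟩
    exact ⟨j, h2, hji, by rw [← vecL_take_reverse τ hi hji]; exact hz, hb⟩
  · rintro ⟨j, h2, hji, hz, hb⟩
    exact ⟨j, by omega, hji, h2, by rw [vecL_take_reverse τ hi hji]; exact hz, hb⟩

/-- ★★ THE ZERO-BLOCK MASKS OF A WORD: `b ∈ zmL n (rawW τ)` iff `b` is the pair mask of a zero block `[i₀, i)` of length `≥ 2`.
[cite: MadrasSlade1993, Definition 1.2.4; lane lemma] -/
theorem mem_zmL_iff (τ : Word L n) (b : ℕ) :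
    b ∈ zmL n (rawW τ) ↔ ∃ i₀ i, i₀ + 2 ≤ i ∧ i ≤ L ∧ bsumW τ i₀ i = 0 ∧ b = pairMask i₀ i := by
  unfold zmL
  rw [List.mem_flatMap]
  simp only [List.mem_range, List.length_ofFn, rawW, List.length_ofFn]
  constructor
  · rintro ⟨i', hi', hb⟩
    rw [show (List.ofFn fun p => raw (τ p)) = rawW τ from rfl, mem_zeroMasks_prefix_iff τ (by omega : i' + 1 ≤ L)] at hb
    obtain ⟨j, h2, hj, hz, hb⟩ := hb
    exact ⟨i' + 1 - j, i' + 1, by omega, by omega, hz, hb⟩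
  · rintro ⟨i₀, i, h2, hiL, hz, hb⟩
    refine ⟨i - 1, by omega, ?_⟩
    rw [show (List.ofFn fun p => raw (τ p)) = rawW τ from rfl, show i - 1 + 1 = i by omega,
      mem_zeroMasks_prefix_iff τ hiL]
    exact ⟨i - i₀, by omega, by omega, by rw [show i - (i - i₀) = i₀ by omega]; exact hz, by rw [show i - (i - i₀) = i₀ by omega]; exact hb⟩

end zeromasks

/-! ### Occurrence counts and the pruning test read -/

section counts

variable {L n : ℕ}

/-- The number of letters of axis `a` in a raw word. [cite: MadrasSlade1993, Definition 1.2.4; lane plumbing] -/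
def occ (w : List (ℕ × Bool)) (a : ℕ) : ℕ := w.countP fun x => x.1 == a

/-- `occ` of an appended letter. [cite: MadrasSlade1993, Definition 1.2.4; lane plumbing] -/
theorem occ_append_singleton (w : List (ℕ × Bool)) (x : ℕ × Bool) (a : ℕ) :
    occ (w ++ [x]) a = occ w a + if x.1 = a then 1 else 0 := by
  unfold occ
  rw [List.countP_append, List.countP_singleton]
  by_cases h : x.1 = a <;> simp [h]

/-- `cntL` of an appended letter. [cite: MadrasSlade1993, Definition 1.2.4; lane plumbing] -/
theorem cntL_append_singleton (w : List (ℕ × Bool)) (x : ℕ × Bool) : cntL (w ++ [x]) = bumpCnt (cntL w) x.1 := by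
  unfold cntL; rw [List.foldl_append]; rfl

/-- Under restricted growth every letter has axis below the running count, and every axis below the count occurs.
[cite: MadrasSlade1993, Definition 1.2.4; lane plumbing] -/
theorem axes_lt_naxL (w : List (ℕ × Bool)) (h : rgOK 0 w = true) :
    (∀ x ∈ w, x.1 < naxL 0 w) ∧ ∀ a < naxL 0 w, 0 < occ w a := by
  induction w using List.reverseRecOn with
  | nil => simp [naxL]
  | append_singleton w x ih =>
    rw [rgOK_append_singleton, Bool.and_eq_true, Nat.ble_eq] at h
    obtain ⟨ih1, ih2⟩ := ih h.1
    rw [naxL_append_singleton]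
    refine ⟨fun y hy => ?_, fun a ha => ?_⟩
    · rw [List.mem_append, List.mem_singleton] at hy
      rcases hy with hy | rfl
      · exact lt_of_lt_of_le (ih1 y hy) (le_max_left _ _)
      · exact lt_of_lt_of_le (Nat.lt_succ_self _) (le_max_right _ _)
    · rw [occ_append_singleton]
      unfold nxt at ha
      by_cases hxa : x.1 = a
      · rw [if_pos hxa]; omega
      · rw [if_neg hxa, add_zero]
        apply ih2
        rcases lt_max_iff.1 ha with ha | ha
        · exact ha
        · omega

/-- ★ THE OCCURRENCE COUNTS READ: under restricted growth, `cntL w` lists `occ w a` for the axes `a < naxL 0 w`.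
[cite: MadrasSlade1993, Definition 1.2.4; lane lemma] -/
theorem cntL_eq (w : List (ℕ × Bool)) (h : rgOK 0 w = true) : cntL w = (List.range (naxL 0 w)).map (occ w) := by
  induction w using List.reverseRecOn with
  | nil => rfl
  | append_singleton w x ih =>
    have h' := h
    rw [rgOK_append_singleton, Bool.and_eq_true, Nat.ble_eq] at h'
    have hax := (axes_lt_naxL w h'.1).1
    rw [cntL_append_singleton, ih h'.1, naxL_append_singleton, bumpCnt, List.length_map, List.length_range]
    by_cases hlt : x.1 < naxL 0 w
    · rw [if_pos hlt, show nxt (naxL 0 w) x = naxL 0 w from max_eq_left (by omega)]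
      apply List.ext_getElem
      · simp
      · intro i h1 h2
        rw [List.length_modify, List.length_map, List.length_range] at h1
        rw [List.getElem_modify, List.getElem_map, List.getElem_range, List.getElem_map, List.getElem_range, occ_append_singleton]
        by_cases hi : x.1 = i
        · subst hi; simp
        · rw [if_neg hi, if_neg hi, add_zero]
    · have hx : x.1 = naxL 0 w := le_antisymm h'.2 (not_lt.1 hlt)
      rw [if_neg hlt, show nxt (naxL 0 w) x = naxL 0 w + 1 by unfold nxt; rw [hx]; exact max_eq_right (Nat.le_succ _),
        List.range_succ, List.map_append, List.map_singleton]
      congr 1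
      · apply List.map_congr_left
        intro a ha
        rw [List.mem_range] at ha
        rw [occ_append_singleton, if_neg (by omega), add_zero]
      · rw [occ_append_singleton, if_pos hx]
        have : occ w (naxL 0 w) = 0 := by
          unfold occ
          rw [List.countP_eq_zero]
          intro y hy hya
          have := hax y hy
          rw [beq_iff_eq] at hya
          omega
        rw [this]

/-- A list sum over `List.range` is a `Finset.range` sum. [cite: MadrasSlade1993, Definition 1.2.4; lane plumbing] -/
theorem sum_map_range (f : ℕ → ℕ) (m : ℕ) : ((List.range m).map f).sum = ∑ a ∈ Finset.range m, f a := by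
  induction m with
  | zero => simp
  | succ m ih => rw [List.range_succ, List.map_append, List.sum_append, ih, Finset.sum_range_succ]; simp

/-- All letters have axis `< M` ⇒ the occurrence counts below `M` add up to the length. [cite: MadrasSlade1993, Definition 1.2.4; lane plumbing] -/
theorem sum_occ_eq_length (w : List (ℕ × Bool)) (M : ℕ) (h : ∀ x ∈ w, x.1 < M) : ∑ a ∈ Finset.range M, occ w a = w.length := by
  induction w using List.reverseRecOn with
  | nil => simp [occ]
  | append_singleton w x ih =>
    have hw : ∀ y ∈ w, y.1 < M := fun y hy => h y (List.mem_append_left _ hy)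
    have hx : x.1 < M := h x (by simp)
    simp only [occ_append_singleton, Finset.sum_add_distrib, ih hw, List.length_append, List.length_singleton]
    rw [Finset.sum_ite_eq (Finset.range M) x.1 (fun _ => 1), if_pos (Finset.mem_range.2 hx)]

/-- Occurrence counts grow along prefixes. [cite: MadrasSlade1993, Definition 1.2.4; lane plumbing] -/
theorem occ_take_le (w : List (ℕ × Bool)) (i a : ℕ) : occ (w.take i) a ≤ occ w a :=
  (List.take_sublist i w).countP_le

/-- Restricted growth passes to prefixes. [cite: MadrasSlade1993, Definition 1.2.4; lane plumbing] -/
theorem rgOK_take (w : List (ℕ × Bool)) (h : rgOK 0 w = true) (i : ℕ) : rgOK 0 (w.take i) = true := by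
  have := rgOK_append 0 (w.take i) (w.drop i)
  rw [List.take_append_drop, h] at this
  exact (Bool.and_eq_true_iff.1 this.symm).1

/-- The running axis count grows along prefixes. [cite: MadrasSlade1993, Definition 1.2.4; lane plumbing] -/
theorem naxL_take_le (w : List (ℕ × Bool)) (i : ℕ) : naxL 0 (w.take i) ≤ naxL 0 w := by
  have := naxL_append 0 (w.take i) (w.drop i)
  rw [List.take_append_drop] at this
  rw [this]; exact le_naxL _ _

/-- ★ THE PRUNING TEST READ at a prefix of a restricted-growth raw word. [cite: MadrasSlade1993, Definition 1.2.4; lane lemma] -/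
theorem shOk_st_iff (u r : ℕ) (w : List (ℕ × Bool)) (h : rgOK 0 w = true) :
    shOk u r (st (shUpd n) shS0 w) = true ↔
      naxL 0 w ≤ r ∧ 2 * (r - naxL 0 w) + ∑ a ∈ Finset.range (naxL 0 w), (2 - occ w a) ≤ u - w.length := by
  unfold shOk
  rw [st_shUpd_cnt, st_shUpd_len, cntL_eq w h, List.length_map, List.length_range, List.map_map, Bool.and_eq_true,
    decide_eq_true_iff, decide_eq_true_iff, ← sum_map_range]
  rfl

end counts

/-! ### Bits: the adjacency vector of a class code, masks -/

section bits

variable {L n : ℕ}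

/-- The adjacency vector coded by `c` for words of length `u`: positions `k, k+1` adjacent iff bit `k` of `c` is set (`k + 1 < u`).
[cite: MadrasSlade1993, Definition 1.2.4; lane tool notion] -/
def adjOf (u c : ℕ) : Fin u → Bool := fun k => decide (k.val + 1 < u) && c.testBit k.val

/-- The bits of a pair mask. [cite: MadrasSlade1993, Definition 1.2.4; lane plumbing] -/
theorem testBit_pairMask (i i' k : ℕ) : (pairMask i i').testBit k = true ↔ i ≤ k ∧ k + 1 < i' := by
  unfold pairMask
  rw [Nat.testBit_mul_two_pow, Bool.and_eq_true, decide_eq_true_iff, Nat.testBit_two_pow_sub_one, decide_eq_true_iff]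
  omega

/-- `b &&& c = b` iff every bit of `b` is a bit of `c`. [cite: MadrasSlade1993, Definition 1.2.4; lane plumbing] -/
theorem land_eq_self_iff (b c : ℕ) : b &&& c = b ↔ ∀ k, b.testBit k = true → c.testBit k = true := by
  constructor
  · intro h k hk
    have := congrArg (fun x => Nat.testBit x k) h
    simp only [Nat.testBit_land, hk, Bool.true_and] at this
    exact this
  · intro h
    apply Nat.eq_of_testBit_eq
    intro k
    rw [Nat.testBit_land]
    cases hb : b.testBit k
    · simp
    · simp [h k hb]

/-- `c &&& m = 0` iff no bit is common. [cite: MadrasSlade1993, Definition 1.2.4; lane plumbing] -/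
theorem land_eq_zero_iff' (c m : ℕ) : c &&& m = 0 ↔ ∀ k, ¬ (c.testBit k = true ∧ m.testBit k = true) := by
  constructor
  · intro h k ⟨h1, h2⟩
    have := congrArg (fun x => Nat.testBit x k) h
    simp only [Nat.testBit_land, h1, h2, Bool.true_and, Nat.zero_testBit] at this
    exact Bool.noConfusion this
  · intro h
    apply Nat.eq_of_testBit_eq
    intro k
    rw [Nat.testBit_land, Nat.zero_testBit]
    cases hc : c.testBit k
    · simp
    · cases hm : m.testBit k
      · simp
      · exact absurd ⟨hc, hm⟩ (h k)

/-- The letters of `rawW`. [cite: MadrasSlade1993, Definition 1.2.4; lane plumbing] -/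
theorem getElem?_rawW (τ : Word L n) (k : ℕ) (hk : k < L) : (rawW τ)[k]? = some (raw (τ ⟨k, hk⟩)) := by
  unfold rawW; rw [List.getElem?_ofFn]; simp [hk]

/-- `rawW` has no letter beyond the length. [cite: MadrasSlade1993, Definition 1.2.4; lane plumbing] -/
theorem getElem?_rawW_of_le (τ : Word L n) (k : ℕ) (hk : L ≤ k) : (rawW τ)[k]? = none := by
  unfold rawW; rw [List.getElem?_ofFn]; simp [not_lt.2 hk]

/-- Raw letters are equal iff the letters are. [cite: MadrasSlade1993, Definition 1.2.4; lane plumbing] -/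
theorem raw_inj {x y : Idx n} : raw x = raw y ↔ x = y := by
  unfold raw
  constructor
  · intro h
    have h1 := congrArg Prod.fst h; have h2 := congrArg Prod.snd h
    exact Prod.ext (Fin.ext h1) h2
  · rintro rfl; rfl

/-- ★ THE REVERSAL MASK OF A WORD: bit `k` is set iff letters `k, k+1` form a reversal. [cite: MadrasSlade1993, Definition 1.2.4; lane lemma] -/
theorem testBit_rv_iff (τ : Word L n) (k : ℕ) :
    (st (shUpd n) shS0 (rawW τ)).rv.testBit k = true ↔ ∃ hk : k + 1 < L, τ ⟨k + 1, hk⟩ = ((τ ⟨k, by omega⟩).1, !(τ ⟨k, by omega⟩).2) := by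
  rw [testBit_st_shUpd_rv]
  constructor
  · rintro ⟨x, h1, h2⟩
    have hk : k + 1 < L := by
      by_contra hh; rw [getElem?_rawW_of_le τ _ (not_lt.1 hh)] at h2; exact absurd h2 (by simp)
    refine ⟨hk, ?_⟩
    rw [getElem?_rawW τ k (by omega), Option.some_inj] at h1
    rw [getElem?_rawW τ (k + 1) hk, Option.some_inj, ← h1] at h2
    have : raw (τ ⟨k + 1, hk⟩) = raw (((τ ⟨k, by omega⟩).1, !(τ ⟨k, by omega⟩).2) : Idx n) := h2
    exact raw_inj.1 this
  · rintro ⟨hk, h⟩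
    refine ⟨raw (τ ⟨k, by omega⟩), getElem?_rawW τ k (by omega), ?_⟩
    rw [getElem?_rawW τ (k + 1) hk, h]; rfl

end bits

/-! ### The class test read: run-wise reversal-freeness and a run-wise zero block -/

section classread

variable {L n : ℕ}

/-- A single letter is not a zero block. [cite: MadrasSlade1993, Definition 1.2.4; lane plumbing] -/
theorem bsumW_succ_ne_zero (τ : Word L n) {i : ℕ} (hi : i < L) : bsumW τ i (i + 1) ≠ 0 := by
  rw [bsumW_succ τ le_rfl hi, bsumW_self, zero_add]
  exact twoStepV_ne_zero n _

/-- ★★ THE CLASS TEST READ: on the final state of a word, `shCls c` holds iff the word is run-wise reversal-free and has a run-wise zero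
block for the adjacency vector `adjOf L c`. [cite: MadrasSlade1993, Definition 1.2.4; lane theorem] -/
theorem shCls_st_iff (τ : Word L n) (c : ℕ) :
    shCls c (st (shUpd n) shS0 (rawW τ)) = true ↔ RunNoRev (adjOf L c) τ ∧ RunHasRep (adjOf L c) τ := by
  unfold shCls
  rw [Bool.and_eq_true, beq_iff_eq, land_eq_zero_iff', List.any_eq_true, st_shUpd_zm]
  refine and_congr ?_ ?_
  · -- run-wise reversal-freeness
    constructor
    · intro h i hi hA hrev
      apply h i.val
      refine ⟨?_, (testBit_rv_iff τ i.val).2 ⟨hi, ?_⟩⟩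
      · unfold adjOf at hA; rw [Bool.and_eq_true] at hA; exact hA.2
      · have : (⟨i.val, by omega⟩ : Fin L) = i := Fin.ext rfl
        rw [this]; exact hrev
    · intro h k ⟨hc, hrv⟩
      obtain ⟨hk, hrev⟩ := (testBit_rv_iff τ k).1 hrv
      refine h ⟨k, by omega⟩ hk ?_ hrev
      unfold adjOf; rw [Bool.and_eq_true, decide_eq_true_iff]; exact ⟨hk, hc⟩
  · -- a run-wise zero block
    constructor
    · rintro ⟨b, hb, hbc⟩
      rw [beq_iff_eq, land_eq_self_iff] at hbc
      obtain ⟨i₀, i, h2, hiL, hz, rfl⟩ := (mem_zmL_iff τ b).1 hb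
      refine ⟨i₀, i, by omega, hiL, fun k hk1 hk2 => ?_, (wordPos_eq_iff_bsumW τ (by omega) hiL).2 hz⟩
      unfold adjOf
      rw [Bool.and_eq_true, decide_eq_true_iff]
      exact ⟨by omega, hbc k.val ((testBit_pairMask i₀ i k.val).2 ⟨hk1, hk2⟩)⟩
    · rintro ⟨i₀, i, hlt, hiL, hA, hpos⟩
      have hz : bsumW τ i₀ i = 0 := (wordPos_eq_iff_bsumW τ hlt.le hiL).1 hpos
      have h2 : i₀ + 2 ≤ i := by
        by_contra hh
        have : i = i₀ + 1 := by omega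
        subst this
        exact bsumW_succ_ne_zero τ (by omega) hz
      refine ⟨pairMask i₀ i, (mem_zmL_iff τ _).2 ⟨i₀, i, h2, hiL, hz, rfl⟩, ?_⟩
      rw [beq_iff_eq, land_eq_self_iff]
      intro k hk
      obtain ⟨hk1, hk2⟩ := (testBit_pairMask i₀ i k).1 hk
      have := hA ⟨k, by omega⟩ hk1 hk2
      unfold adjOf at this; rw [Bool.and_eq_true] at this
      exact this.2

end classread

/-! ### Every position repeated: the pruning test along the prefixes -/

section allrep

variable {L n : ℕ}

/-- `countP` as a sum of indicators. [cite: MadrasSlade1993, Definition 1.2.4; lane plumbing] -/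
theorem countP_eq_sum_map_ite {α : Type*} (p : α → Bool) (l : List α) :
    l.countP p = (l.map fun x => if p x = true then 1 else 0).sum := by
  induction l with
  | nil => simp
  | cons a l ih =>
    rw [List.countP_cons, List.map_cons, List.sum_cons, ih]
    by_cases h : p a = true
    · simp only [if_pos h]; omega
    · simp only [if_neg h]; omega

/-- ★ The occurrence count of an axis in `rawW τ` is the number of positions of `τ` on that axis. [cite: MadrasSlade1993, Definition 1.2.4; lane lemma] -/
theorem occ_rawW_eq_card (τ : Word L n) (a : ℕ) :
    occ (rawW τ) a = (Finset.univ.filter fun p : Fin L => (τ p).1.val = a).card := by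
  unfold occ rawW
  rw [countP_eq_sum_map_ite, List.map_ofFn, List.sum_ofFn, Finset.card_filter]
  refine Finset.sum_congr rfl fun p _ => ?_
  simp only [Function.comp, raw, beq_iff_eq]

/-- ★ A position is repeated iff its axis occurs at least twice. [cite: MadrasSlade1993, Definition 1.2.4; lane lemma] -/
theorem isRep_iff_two_le_occ (τ : Word L n) (p : Fin L) : IsRep τ p ↔ 2 ≤ occ (rawW τ) (τ p).1.val := by
  rw [occ_rawW_eq_card]
  have hp : p ∈ Finset.univ.filter fun q : Fin L => (τ q).1.val = (τ p).1.val := by simp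
  constructor
  · rintro ⟨q, hqp, hq⟩
    have hq' : q ∈ Finset.univ.filter fun q : Fin L => (τ q).1.val = (τ p).1.val := by simp [hq]
    exact Finset.one_lt_card.2 ⟨q, hq', p, hp, hqp⟩
  · intro h
    obtain ⟨a, ha, b, hb, hab⟩ := Finset.one_lt_card.1 h
    simp only [Finset.mem_filter, Finset.mem_univ, true_and] at ha hb
    by_cases hap : a = p
    · subst hap; exact ⟨b, fun h => hab h.symm, Fin.ext hb⟩
    · exact ⟨a, hap, Fin.ext ha⟩

/-- ★ For a restricted-growth word: every position is repeated iff every axis below the axis count occurs at least twice.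
[cite: MadrasSlade1993, Definition 1.2.4; lane lemma] -/
theorem allRep_iff_occ (τ : Word L n) (hg : GrowthOK τ) :
    (∀ p, IsRep τ p) ↔ ∀ a < naxL 0 (rawW τ), 2 ≤ occ (rawW τ) a := by
  have hrg : rgOK 0 (rawW τ) = true := (growthOK_iff_rgOK τ).1 hg
  obtain ⟨hax, hocc⟩ := axes_lt_naxL (rawW τ) hrg
  constructor
  · intro h a ha
    have hpos := hocc a ha
    rw [occ_rawW_eq_card, Finset.card_pos] at hpos
    obtain ⟨p, hp⟩ := hpos
    simp only [Finset.mem_filter, Finset.mem_univ, true_and] at hp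
    rw [← hp]
    exact (isRep_iff_two_le_occ τ p).1 (h p)
  · intro h p
    rw [isRep_iff_two_le_occ]
    apply h
    have hmem : raw (τ p) ∈ rawW τ := by unfold rawW; rw [List.mem_ofFn]; exact ⟨p, rfl⟩
    exact hax _ hmem

/-- ★★ THE PRUNING TEST ALONG THE PREFIXES: for a canonical word with `r` axes, every prefix state passes `shOk L r` iff every position
is repeated. [cite: MadrasSlade1993, Definition 1.2.4; lane theorem] -/
theorem prefixOK_shOk_iff (τ : Word L n) (hg : GrowthOK τ) {r : ℕ} (hr : numAxes τ = r) :
    PrefixOK (shUpd n) (shOk L r) shS0 τ ↔ ∀ p, IsRep τ p := by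
  have hrg : rgOK 0 (rawW τ) = true := (growthOK_iff_rgOK τ).1 hg
  have hm : naxL 0 (rawW τ) = r := by rw [← numAxes_eq_naxL τ hg.axFixed, hr]
  have hlen : (rawW τ).length = L := by simp [rawW]
  obtain ⟨hax, -⟩ := axes_lt_naxL (rawW τ) hrg
  rw [allRep_iff_occ τ hg, hm]
  constructor
  · intro h a ha
    have hL := h ⟨L, Nat.lt_succ_self L⟩
    simp only at hL
    rw [List.take_of_length_le (by omega), shOk_st_iff _ _ _ hrg, hm, hlen, Nat.sub_self, Nat.sub_self, mul_zero, zero_add,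
      Nat.le_zero, Finset.sum_eq_zero_iff] at hL
    have := hL.2 a (Finset.mem_range.2 ha)
    omega
  · intro h i
    have hi : i.val ≤ L := Nat.le_of_lt_succ i.isLt
    set w := (rawW τ).take i.val with hw
    have hrgw : rgOK 0 w = true := rgOK_take _ hrg _
    have hwlen : w.length = i.val := by rw [hw, List.length_take, hlen, Nat.min_eq_left hi]
    rw [shOk_st_iff _ _ _ hrgw, hwlen]
    have hmi : naxL 0 w ≤ r := hm ▸ naxL_take_le (rawW τ) i.val
    refine ⟨hmi, ?_⟩
    obtain ⟨haxw, -⟩ := axes_lt_naxL w hrgw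
    have hsum_i : ∑ a ∈ Finset.range (naxL 0 w), occ w a = i.val := by rw [sum_occ_eq_length w _ haxw, hwlen]
    have hsum_L : ∑ a ∈ Finset.range r, occ (rawW τ) a = L := by
      rw [sum_occ_eq_length (rawW τ) r (fun x hx => hm ▸ hax x hx), hlen]
    have hle : ∀ a, occ w a ≤ occ (rawW τ) a := fun a => occ_take_le _ _ _
    -- the missing occurrences fit: compare with the final counts
    have h1 : ∑ a ∈ Finset.range (naxL 0 w), (2 - occ w a) + i.val ≤ ∑ a ∈ Finset.range (naxL 0 w), occ (rawW τ) a := by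
      rw [← hsum_i, ← Finset.sum_add_distrib]
      refine Finset.sum_le_sum fun a ha => ?_
      have h2a := h a (lt_of_lt_of_le (Finset.mem_range.1 ha) hmi)
      have hla := hle a
      omega
    have h2 : 2 * (r - naxL 0 w) ≤ ∑ a ∈ Finset.Ico (naxL 0 w) r, occ (rawW τ) a := by
      have : 2 * (r - naxL 0 w) = ∑ a ∈ Finset.Ico (naxL 0 w) r, 2 := by
        rw [Finset.sum_const, Nat.card_Ico, smul_eq_mul, mul_comm]
      rw [this]
      exact Finset.sum_le_sum fun a ha => h a (Finset.mem_Ico.1 ha).2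
    have h3 : ∑ a ∈ Finset.range (naxL 0 w), occ (rawW τ) a + ∑ a ∈ Finset.Ico (naxL 0 w) r, occ (rawW τ) a = L := by
      rw [Finset.range_eq_Ico, Finset.sum_Ico_consecutive _ (Nat.zero_le _) hmi, ← Finset.range_eq_Ico, hsum_L]
    omega

end allrep

/-! ### The shape predicate, its flip invariance, and the count theorem -/

section count

variable {L n : ℕ}

/-- The SHAPE PREDICATE of class code `c`: every position repeated, run-wise reversal-free and with a run-wise zero block for the adjacency
vector `adjOf L c`. [cite: MadrasSlade1993, Definition 1.2.4; lane tool notion] -/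
def ShapeP (L c : ℕ) {n : ℕ} (κ : Word L n) : Prop := (∀ p, IsRep κ p) ∧ RunNoRev (adjOf L c) κ ∧ RunHasRep (adjOf L c) κ

/-- A sign flip by axes commutes with reversal of letters. [cite: MadrasSlade1993, Definition 1.2.4; lane plumbing] -/
theorem flipW_eq_rev_iff (S : Finset (Fin n)) (τ : Word L n) (p q : Fin L) :
    flipW S τ q = ((flipW S τ p).1, !(flipW S τ p).2) ↔ τ q = ((τ p).1, !(τ p).2) := by
  rw [Prod.ext_iff, Prod.ext_iff, flipW_fst, flipW_fst, flipW_snd, flipW_snd]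
  simp only
  constructor
  · rintro ⟨h1, h2⟩
    refine ⟨h1, ?_⟩
    rw [h1] at h2
    by_cases hm : (τ p).1 ∈ S
    · rw [if_pos hm, if_pos hm] at h2; exact Bool.not_inj h2
    · rw [if_neg hm, if_neg hm] at h2; exact h2
  · rintro ⟨h1, h2⟩
    refine ⟨h1, ?_⟩
    rw [h1, h2]
    by_cases hm : (τ p).1 ∈ S
    · rw [if_pos hm, if_pos hm]
    · rw [if_neg hm, if_neg hm]

/-- ★ The shape predicate is invariant under sign flips by axes. [cite: MadrasSlade1993, Definition 1.2.4; lane lemma] -/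
theorem shapeP_flipW_iff (c : ℕ) (S : Finset (Fin n)) (τ : Word L n) : ShapeP L c (flipW S τ) ↔ ShapeP L c τ := by
  unfold ShapeP
  refine and_congr ?_ (and_congr ?_ ?_)
  · refine forall_congr' fun p => ?_
    unfold IsRep
    simp only [flipW_fst]
  · unfold RunNoRev
    refine forall_congr' fun i => forall_congr' fun hi => forall_congr' fun _ => ?_
    exact not_congr (flipW_eq_rev_iff S τ i ⟨i.val + 1, hi⟩)
  · unfold RunHasRep
    refine exists_congr fun i => exists_congr fun i' => and_congr_right fun hii' => and_congr_right fun hi' =>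
      and_congr_right fun _ => ?_
    rw [wordPos_eq_iff_bsumW _ hii'.le hi', wordPos_eq_iff_bsumW _ hii'.le hi', bsumW, bsumW, sum_flipW_eq_zero_iff]

open Classical in
/-- The shape class is the transversal filtered by the shape predicate. [cite: MadrasSlade1993, Definition 1.2.4; lane plumbing] -/
theorem shapeClass_eq_filter_TL (j u c : ℕ) (hju : j ≤ u) :
    shapeClass j u (adjOf u c) = (TL u).filter fun κ => ShapeP u c κ ∧ numAxes κ = u - j := by
  ext κ
  unfold shapeClass TL ShapeP
  simp only [Finset.mem_filter, Finset.mem_univ, true_and]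
  constructor
  · rintro ⟨h1, h2, h3, h4, h5⟩; exact ⟨h1, ⟨h3, h4, h5⟩, by omega⟩
  · rintro ⟨h1, ⟨h3, h4, h5⟩, h2⟩; exact ⟨h1, by omega, h3, h4, h5⟩

open Classical in
/-- ★★★ THE SHAPE COUNT THEOREM: the shape class of the adjacency vector coded by `c` has `2^(u−j)` times the reduced-search count of class
`c` with `u − j` axes — `#shapeClass_j(u, A_c) = 2^(u−j) · dfsN alwR (shUpd u) (shOk u (u−j)) shCls c (u−j) u shS0 0`.
[cite: MadrasSlade1993, Definition 1.2.4; lane theorem] -/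
theorem card_shapeClass_adjOf (j u c : ℕ) (hju : j ≤ u) :
    (shapeClass j u (adjOf u c)).card = 2 ^ (u - j) * dfsN alwR (shUpd u) (shOk u (u - j)) shCls c (u - j) u shS0 0 := by
  rw [shapeClass_eq_filter_TL j u c hju,
    card_filter_eq_two_pow_mul_card (TL u) flipW_mem_TL (ShapeP u c) (fun S τ => shapeP_flipW_iff c S τ) (u - j),
    ← card_TL_class alwR (shUpd u) (shOk u (u - j)) shCls shS0 c (u - j), Finset.filter_filter]
  congr 2
  refine Finset.filter_congr fun τ hτ => ?_
  have hg : GrowthOK τ := (growthOK_iff_canon_eq τ).2 (canon_TL τ hτ)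
  rw [rgA_alwR_iff]
  constructor
  · rintro ⟨⟨⟨h1, h2, h3⟩, hfp⟩, hr⟩
    exact ⟨⟨⟨hg, hfp⟩, (prefixOK_shOk_iff τ hg hr).2 h1, (shCls_st_iff τ c).2 ⟨h2, h3⟩⟩, hr⟩
  · rintro ⟨⟨⟨-, hfp⟩, hpre, hcls⟩, hr⟩
    exact ⟨⟨⟨(prefixOK_shOk_iff τ hg hr).1 hpre, (shCls_st_iff τ c).1 hcls⟩, hfp⟩, hr⟩

end count

/-! ### The kernel cells of the `j = 4` shape census (word lengths `u = 4, …, 8`, `u − 4` axes) -/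

section cells

/-- Census table, `u = 4` (no shapes). [cite: MadrasSlade1993, Definition 1.2.4; lane census] -/
def shTab4 : List (List ℕ) := List.replicate 8 (List.replicate 5 0)

/-- Census table, `u = 5` (no shapes). [cite: MadrasSlade1993, Definition 1.2.4; lane census] -/
def shTab5 : List (List ℕ) := List.replicate 16 (List.replicate 6 0)

/-- Census table, `u = 6`: row `c` (class code), column `k` (number of axes) — reduced canonical words. [cite: MadrasSlade1993, Definition 1.2.4; lane census] -/
def shTab6 : List (List ℕ) := [[0, 0, 0, 0, 0, 0, 0], [0, 0, 0, 0, 0, 0, 0], [0, 0, 0, 0, 0, 0, 0], [0, 0, 0, 0, 0, 0, 0], [0, 0, 0, 0, 0, 0, 0], [0, 0, 0, 0, 0, 0, 0], [0, 0, 0, 0, 0, 0, 0], [0, 0, 16, 0, 0, 0, 0], [0, 0, 0, 0, 0, 0, 0], [0, 0, 0, 0, 0, 0, 0], [0, 0, 0, 0, 0, 0, 0], [0, 0, 0, 0, 0, 0, 0], [0, 0, 0, 0, 0, 0, 0], [0, 0, 0, 0, 0, 0, 0], [0, 0, 16, 0, 0, 0, 0], [0, 0, 20, 0, 0, 0, 0],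 [0, 0, 0, 0, 0, 0, 0], [0, 0, 0, 0, 0, 0, 0], [0, 0, 0, 0, 0, 0, 0], [0, 0, 0, 0, 0, 0, 0], [0, 0, 0, 0, 0, 0, 0], [0, 0, 0, 0, 0, 0, 0], [0, 0, 0, 0, 0, 0, 0], [0, 0, 12, 0, 0, 0, 0], [0, 0, 0, 0, 0, 0, 0], [0, 0, 0, 0, 0, 0, 0], [0, 0, 0, 0, 0, 0, 0], [0, 0, 0, 0, 0, 0, 0], [0, 0, 16, 0, 0, 0, 0], [0, 0, 12, 0, 0, 0, 0], [0, 0, 20, 0, 0, 0, 0], [0, 0, 24, 0, 0, 0, 0]]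

/-- Census table, `u = 7`: row `c` (class code), column `k` (number of axes) — reduced canonical words. [cite: MadrasSlade1993, Definition 1.2.4; lane census] -/
def shTab7 : List (List ℕ) := [[0, 0, 0, 0, 0, 0, 0, 0], [0, 0, 0, 0, 0, 0, 0, 0], [0, 0, 0, 0, 0, 0, 0, 0], [0, 0, 0, 0, 0, 0, 0, 0], [0, 0, 0, 0, 0, 0, 0, 0], [0, 0, 0, 0, 0, 0, 0, 0], [0, 0, 0, 0, 0, 0, 0, 0], [0, 0, 0, 28, 0, 0, 0, 0], [0, 0, 0, 0, 0, 0, 0, 0], [0, 0, 0, 0, 0, 0, 0, 0], [0, 0, 0, 0, 0, 0, 0, 0], [0, 0, 0, 0, 0, 0, 0, 0], [0, 0, 0, 0, 0, 0, 0, 0], [0, 0, 0, 0, 0, 0, 0, 0], [0, 0, 0, 28, 0, 0, 0, 0], [0, 0, 0, 50, 0, 0, 0, 0], [0, 0, 0, 0, 0, 0, 0, 0], [0, 0, 0, 0, 0, 0, 0, 0], [0, 0, 0, 0, 0, 0, 0, 0], [0, 0, 0, 0, 0, 0, 0, 0], [0, 0, 0, 0, 0, 0, 0, 0], [0, 0,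 0, 0, 0, 0, 0, 0], [0, 0, 0, 0, 0, 0, 0, 0], [0, 0, 0, 22, 0, 0, 0, 0], [0, 0, 0, 0, 0, 0, 0, 0], [0, 0, 0, 0, 0, 0, 0, 0], [0, 0, 0, 0, 0, 0, 0, 0], [0, 0, 0, 0, 0, 0, 0, 0], [0, 0, 0, 28, 0, 0, 0, 0], [0, 0, 0, 22, 0, 0, 0, 0], [0, 0, 0, 50, 0, 0, 0, 0], [0, 0, 0, 84, 0, 0, 0, 0], [0, 0, 0, 0, 0, 0, 0, 0], [0, 0, 0, 0, 0, 0, 0, 0], [0, 0, 0, 0, 0, 0, 0, 0], [0, 0, 0, 0, 0, 0, 0, 0], [0, 0, 0, 0, 0, 0, 0, 0], [0, 0, 0, 0, 0, 0, 0, 0], [0, 0, 0, 0, 0, 0, 0, 0], [0, 0, 0, 22, 0, 0, 0, 0], [0, 0, 0, 0, 0, 0, 0, 0], [0, 0, 0, 0, 0, 0, 0, 0], [0, 0, 0, 0, 0, 0, 0, 0], [0, 0, 0, 0, 0, 0, 0, 0], [0, 0, 0, 0, 0, 0, 0, 0], [0, 0, 0, 0, 0, 0, 0, 0], [0, 0,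 0, 22, 0, 0, 0, 0], [0, 0, 0, 41, 0, 0, 0, 0], [0, 0, 0, 0, 0, 0, 0, 0], [0, 0, 0, 0, 0, 0, 0, 0], [0, 0, 0, 0, 0, 0, 0, 0], [0, 0, 0, 0, 0, 0, 0, 0], [0, 0, 0, 0, 0, 0, 0, 0], [0, 0, 0, 0, 0, 0, 0, 0], [0, 0, 0, 0, 0, 0, 0, 0], [0, 0, 0, 17, 0, 0, 0, 0], [0, 0, 0, 28, 0, 0, 0, 0], [0, 0, 0, 22, 0, 0, 0, 0], [0, 0, 0, 22, 0, 0, 0, 0], [0, 0, 0, 17, 0, 0, 0, 0], [0, 0, 0, 50, 0, 0, 0, 0], [0, 0, 0, 41, 0, 0, 0, 0], [0, 0, 0, 84, 0, 0, 0, 0], [0, 0, 0, 99, 0, 0, 0, 0]]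

/-- Census table, `u = 8`: row `c` (class code), column `k` (number of axes) — reduced canonical words. [cite: MadrasSlade1993, Definition 1.2.4; lane census] -/
def shTab8 : List (List ℕ) := [[0, 0, 0, 0, 0, 0, 0, 0, 0], [0, 0, 0, 0, 0, 0, 0, 0, 0], [0, 0, 0, 0, 0, 0, 0, 0, 0], [0, 0, 0, 0, 0, 0, 0, 0, 0], [0, 0, 0, 0, 0, 0, 0, 0, 0], [0, 0, 0, 0, 0, 0, 0, 0, 0], [0, 0, 0, 0, 0, 0, 0, 0, 0], [0, 0, 0, 0, 12, 0, 0, 0, 0], [0, 0, 0, 0, 0, 0, 0, 0, 0], [0, 0, 0, 0, 0, 0, 0, 0, 0], [0, 0, 0, 0, 0, 0, 0, 0, 0], [0, 0, 0, 0, 0, 0, 0, 0, 0], [0, 0, 0, 0, 0, 0, 0, 0, 0], [0, 0, 0, 0, 0, 0, 0, 0, 0], [0, 0, 0, 0, 12, 0, 0, 0, 0], [0, 0, 0, 0, 24, 0, 0, 0, 0], [0, 0, 0, 0, 0, 0, 0, 0, 0], [0, 0, 0, 0, 0, 0, 0, 0, 0], [0, 0, 0, 0, 0, 0, 0, 0,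 0], [0, 0, 0, 0, 0, 0, 0, 0, 0], [0, 0, 0, 0, 0, 0, 0, 0, 0], [0, 0, 0, 0, 0, 0, 0, 0, 0], [0, 0, 0, 0, 0, 0, 0, 0, 0], [0, 0, 0, 0, 10, 0, 0, 0, 0], [0, 0, 0, 0, 0, 0, 0, 0, 0], [0, 0, 0, 0, 0, 0, 0, 0, 0], [0, 0, 0, 0, 0, 0, 0, 0, 0], [0, 0, 0, 0, 0, 0, 0, 0, 0], [0, 0, 0, 0, 12, 0, 0, 0, 0], [0, 0, 0, 0, 10, 0, 0, 0, 0], [0, 0, 0, 0, 24, 0, 0, 0, 0], [0, 0, 0, 0, 40, 0, 0, 0, 0], [0, 0, 0, 0, 0, 0, 0, 0, 0], [0, 0, 0, 0, 0, 0, 0, 0, 0], [0, 0, 0, 0, 0, 0, 0, 0, 0], [0, 0, 0, 0, 0, 0, 0, 0, 0], [0, 0, 0, 0, 0, 0, 0, 0, 0], [0, 0, 0, 0, 0, 0, 0, 0, 0], [0, 0, 0, 0, 0, 0, 0, 0, 0], [0, 0, 0, 0, 10, 0, 0, 0, 0], [0, 0, 0, 0, 0, 0, 0, 0, 0], [0,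 0, 0, 0, 0, 0, 0, 0, 0], [0, 0, 0, 0, 0, 0, 0, 0, 0], [0, 0, 0, 0, 0, 0, 0, 0, 0], [0, 0, 0, 0, 0, 0, 0, 0, 0], [0, 0, 0, 0, 0, 0, 0, 0, 0], [0, 0, 0, 0, 10, 0, 0, 0, 0], [0, 0, 0, 0, 20, 0, 0, 0, 0], [0, 0, 0, 0, 0, 0, 0, 0, 0], [0, 0, 0, 0, 0, 0, 0, 0, 0], [0, 0, 0, 0, 0, 0, 0, 0, 0], [0, 0, 0, 0, 0, 0, 0, 0, 0], [0, 0, 0, 0, 0, 0, 0, 0, 0], [0, 0, 0, 0, 0, 0, 0, 0, 0], [0, 0, 0, 0, 0, 0, 0, 0, 0], [0, 0, 0, 0, 8, 0, 0, 0, 0], [0, 0, 0, 0, 12, 0, 0, 0, 0], [0, 0, 0, 0, 10, 0, 0, 0, 0], [0, 0, 0, 0, 10, 0, 0, 0, 0], [0, 0, 0, 0, 8, 0, 0, 0, 0], [0, 0, 0, 0, 24, 0, 0, 0, 0], [0, 0, 0, 0, 20, 0, 0, 0, 0], [0, 0, 0, 0, 40, 0, 0, 0, 0], [0, 0, 0,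 0, 52, 0, 0, 0, 0], [0, 0, 0, 0, 0, 0, 0, 0, 0], [0, 0, 0, 0, 0, 0, 0, 0, 0], [0, 0, 0, 0, 0, 0, 0, 0, 0], [0, 0, 0, 0, 0, 0, 0, 0, 0], [0, 0, 0, 0, 0, 0, 0, 0, 0], [0, 0, 0, 0, 0, 0, 0, 0, 0], [0, 0, 0, 0, 0, 0, 0, 0, 0], [0, 0, 0, 0, 10, 0, 0, 0, 0], [0, 0, 0, 0, 0, 0, 0, 0, 0], [0, 0, 0, 0, 0, 0, 0, 0, 0], [0, 0, 0, 0, 0, 0, 0, 0, 0], [0, 0, 0, 0, 0, 0, 0, 0, 0], [0, 0, 0, 0, 0, 0, 0, 0, 0], [0, 0, 0, 0, 0, 0, 0, 0, 0], [0, 0, 0, 0, 10, 0, 0, 0, 0], [0, 0, 0, 0, 20, 0, 0, 0, 0], [0, 0, 0, 0, 0, 0, 0, 0, 0], [0, 0, 0, 0, 0, 0, 0, 0, 0], [0, 0, 0, 0, 0, 0, 0, 0, 0], [0, 0, 0, 0, 0, 0, 0, 0, 0], [0, 0, 0, 0, 0, 0, 0, 0, 0], [0, 0, 0, 0, 0,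 0, 0, 0, 0], [0, 0, 0, 0, 0, 0, 0, 0, 0], [0, 0, 0, 0, 9, 0, 0, 0, 0], [0, 0, 0, 0, 0, 0, 0, 0, 0], [0, 0, 0, 0, 0, 0, 0, 0, 0], [0, 0, 0, 0, 0, 0, 0, 0, 0], [0, 0, 0, 0, 0, 0, 0, 0, 0], [0, 0, 0, 0, 10, 0, 0, 0, 0], [0, 0, 0, 0, 9, 0, 0, 0, 0], [0, 0, 0, 0, 20, 0, 0, 0, 0], [0, 0, 0, 0, 32, 0, 0, 0, 0], [0, 0, 0, 0, 0, 0, 0, 0, 0], [0, 0, 0, 0, 0, 0, 0, 0, 0], [0, 0, 0, 0, 0, 0, 0, 0, 0], [0, 0, 0, 0, 0, 0, 0, 0, 0], [0, 0, 0, 0, 0, 0, 0, 0, 0], [0, 0, 0, 0, 0, 0, 0, 0, 0], [0, 0, 0, 0, 0, 0, 0, 0, 0], [0, 0, 0, 0, 8, 0, 0, 0, 0], [0, 0, 0, 0, 0, 0, 0, 0, 0], [0, 0, 0, 0, 0, 0, 0, 0, 0], [0, 0, 0, 0, 0, 0, 0, 0, 0], [0, 0, 0, 0, 0, 0, 0,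 0, 0], [0, 0, 0, 0, 0, 0, 0, 0, 0], [0, 0, 0, 0, 0, 0, 0, 0, 0], [0, 0, 0, 0, 8, 0, 0, 0, 0], [0, 0, 0, 0, 16, 0, 0, 0, 0], [0, 0, 0, 0, 12, 0, 0, 0, 0], [0, 0, 0, 0, 10, 0, 0, 0, 0], [0, 0, 0, 0, 10, 0, 0, 0, 0], [0, 0, 0, 0, 8, 0, 0, 0, 0], [0, 0, 0, 0, 10, 0, 0, 0, 0], [0, 0, 0, 0, 9, 0, 0, 0, 0], [0, 0, 0, 0, 8, 0, 0, 0, 0], [0, 0, 0, 0, 13, 0, 0, 0, 0], [0, 0, 0, 0, 24, 0, 0, 0, 0], [0, 0, 0, 0, 20, 0, 0, 0, 0], [0, 0, 0, 0, 20, 0, 0, 0, 0], [0, 0, 0, 0, 16, 0, 0, 0, 0], [0, 0, 0, 0, 40, 0, 0, 0, 0], [0, 0, 0, 0, 32, 0, 0, 0, 0], [0, 0, 0, 0, 52, 0, 0, 0, 0], [0, 0, 0, 0, 81, 0, 0, 0, 0]]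

/-- The census tables by word length. [cite: MadrasSlade1993, Definition 1.2.4; lane census] -/
def shTab (u : ℕ) : List (List ℕ) :=
  if u = 4 then shTab4 else if u = 5 then shTab5 else if u = 6 then shTab6 else if u = 7 then shTab7 else if u = 8 then shTab8 else []

/-- KERNEL CELL `u = 4`: the reduced shape census (empty). [cite: MadrasSlade1993, Definition 1.2.4; lane census] -/
theorem shV_four : shV 4 0 (2 ^ 33) = Nat.ofDigits ((2 ^ 33) ^ 5) (shTab4.map (Nat.ofDigits (2 ^ 33))) := by decide +kernel

/-- KERNEL CELL `u = 5`: the reduced shape census (empty). [cite: MadrasSlade1993, Definition 1.2.4; lane census] -/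
theorem shV_five : shV 5 1 (2 ^ 33) = Nat.ofDigits ((2 ^ 33) ^ 6) (shTab5.map (Nat.ofDigits (2 ^ 33))) := by decide +kernel

/-- ★ KERNEL CELL `u = 6`: the reduced shape census of the 2-axis shapes of excess four (25 = 16 + … reduced canonical words by class).
[cite: MadrasSlade1993, Definition 1.2.4; lane census] -/
theorem shV_six : shV 6 2 (2 ^ 33) = Nat.ofDigits ((2 ^ 33) ^ 7) (shTab6.map (Nat.ofDigits (2 ^ 33))) := by decide +kernel

/-- ★ KERNEL CELL `u = 7`: the reduced shape census of the 3-axis shapes of excess four. [cite: MadrasSlade1993, Definition 1.2.4; lane census] -/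
theorem shV_seven : shV 7 3 (2 ^ 33) = Nat.ofDigits ((2 ^ 33) ^ 8) (shTab7.map (Nat.ofDigits (2 ^ 33))) := by decide +kernel

/-- ★ KERNEL CELL `u = 8`: the reduced shape census of the 4-axis shapes of excess four (the 105 pairings). [cite: MadrasSlade1993, Definition 1.2.4; lane census] -/
theorem shV_eight : shV 8 4 (2 ^ 33) = Nat.ofDigits ((2 ^ 33) ^ 9) (shTab8.map (Nat.ofDigits (2 ^ 33))) := by decide +kernel

/-- The reduced count of class `c` with `u − 4` axes, read from the tables. [cite: MadrasSlade1993, Definition 1.2.4; lane census] -/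
def shN (u c : ℕ) : ℕ := ((shTab u).getD c []).getD (u - 4) 0

/-- ★ THE DIGITS READ: for `4 ≤ u ≤ 8` and `c < 2^(u−1)`, the reduced search count of class `c` with `u − 4` axes is the table entry.
[cite: MadrasSlade1993, Definition 1.2.4; lane census] -/
theorem dfsN_eq_shN (u c : ℕ) (hu : 4 ≤ u) (hu' : u ≤ 8) (hc : c < 2 ^ (u - 1)) :
    dfsN alwR (shUpd u) (shOk u (u - 4)) shCls c (u - 4) u shS0 0 = shN u c := by
  unfold shN
  have hV : ∀ u', 4 ≤ u' → u' ≤ 8 → dfsV alwR (shUpd u') (shOk u' (u' - 4)) shCls (2 ^ (u' - 1)) (u' + 1) (2 ^ 33) u' shS0 0 =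
      Nat.ofDigits ((2 ^ 33) ^ (u' + 1)) ((shTab u').map (Nat.ofDigits (2 ^ 33))) := by
    intro u' h1 h2
    interval_cases u'
    · exact shV_four
    · exact shV_five
    · exact shV_six
    · exact shV_seven
    · exact shV_eight
  refine dfsN_eq_of_table alwR (shUpd u) (shOk u (u - 4)) shCls shS0 (C := 2 ^ (u - 1)) (L := u) (B := 2 ^ 33) ?_ (shTab u)
    ?_ ?_ ?_ (hV u hu hu') hc (Nat.sub_le u 4)
  · interval_cases u <;> norm_num
  · interval_cases u <;> decide +kernel
  · interval_cases u <;> decide +kernel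
  · interval_cases u <;> decide +kernel

/-- ★★ THE SHAPE CLASS CARDINALITIES of excess four: `#shapeClass_4(u, A_c) = 2^(u−4) · shN u c` (`4 ≤ u ≤ 8`, `c < 2^(u−1)`).
[cite: MadrasSlade1993, Definition 1.2.4; lane census] -/
theorem card_shapeClass_four (u c : ℕ) (hu : 4 ≤ u) (hu' : u ≤ 8) (hc : c < 2 ^ (u - 1)) :
    (shapeClass 4 u (adjOf u c)).card = 2 ^ (u - 4) * shN u c := by
  rw [card_shapeClass_adjOf 4 u c hu, dfsN_eq_shN u c hu hu' hc]

open Classical in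
/-- No shapes of excess four on fewer than four letters. [cite: MadrasSlade1993, Definition 1.2.4; lane plumbing] -/
theorem shapeClass_four_eq_empty {u : ℕ} (hu : u < 4) (A : Fin u → Bool) : shapeClass 4 u A = ∅ := by
  unfold shapeClass
  exact Finset.filter_eq_empty_iff.2 fun κ _ h => by omega

end cells


end WordTypes

end Literature.Probability.RandomPlanarGeometry.SAW.Zd
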